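import Summits.QuantumFields.YangMills.Theorems.FluctuationComparisonRegPrIntLS2BetaCritMOfChartReadDescent
import HarnessLib

/-!
# S2β · CRIT-m♮ ∧ «DM ONTO» IN THE QUATERNION (ℝ³) READ — the (PRE) currency of ✓p824141 `multAx_of_preimages`

Cell `ym3-torus` (YM ladder rung R3 = continuum `SU(2)` Yang–Mills on the three-torus at fixed lattice data — a RUNG: NOT d = 4, NOT infinite volume, NOT a mass gap,
NOT Clay).  Width seat `ym3-torus-px5` (gen 22); crux `stmt-QuantumFields-20520` (`…Theses.UnitScaleTilt.FluctuationComparisonRegPrIntL`), LINE g18-1 S2β, organ GAP♯∘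
⟸ «CRIT-ax» (✓p823293) ⟸ «MULT♭-ax» (✓p824141) ⟸ (PRE) = {CRIT-m♮ set form, (RINV-curl), AVG₂♭-ax} ∧ BKG (✓p822405); `--kind proof --supports stmt-QuantumFields-20520
--as helper`, count-neutral, DEFINITION-FREE (0 `def`, 0 `instance`, 0 `notation`, 0 `sorry`, default heartbeats).

WHY.  ✓p824591 `…CritMOfChartReadDescent` proves CRIT-m♮ ∧ onto for the `𝔰𝔲(2)`-valued continuous-linear `DM(U₀) := fderiv (B ↦ Λ(D(expPoint ζ•U₀) B·D(U₀) B⁻¹)) 0`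
(`Λ` = the log chart of `isChartRep_specialUnitaryGroup`).  The (PRE) hypothesis of ✓p824141 quantifies over ONE `DM : (PBond K → ℝ³) → (PBond J → ℝ³)` — ℝ³-VALUED,
shared by its three conjuncts, the third of which (AVG₂♭-ax) feeds `DM` with the quaternion chart `ℓ ↦ imVec (su2Quat (U ℓ·U₀ ℓ⁻¹))` and norms its output in `ℝ³`.  The
canonical ℝ³ reading of the same derivative is the QUATERNION READ
`DMq(U₀) := fderiv ℝ (fun ζ B => imVec (su2Quat (descendTo F ℰp J K hJK (ℓ ↦ expPoint (ζ ℓ)·U₀ ℓ) B · (descendTo F ℰp J K hJK U₀ B)⁻¹))) 0`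
(fine chart `expPoint`, coarse chart `imVec ∘ su2Quat` — both tangent to the identity).  THIS FILE: `DMq = E⁻¹ ∘L DM` for every bond-wise Pauli coordinate equivalence `E`
of ✓`exists_coordEquiv` (so `DMq` is the STRICT derivative, is ONTO, and everything proved for `DM` transfers), and CRIT-m♮ for `DMq` in multiplier AND set form, in the
registry prefix, OUTRIGHT at every `L ≥ 5`.

WHAT IS PROVED (sorry-free).
§1 `hasStrictFDerivAt_imVec_su2Quat_expPoint` — `x ↦ imVec (su2Quat (expPoint x))` has strict derivative `id` at `0` (`su2Quat ∘ expPoint = exp ∘ imQuat`,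
   `hasStrictFDerivAt_exp_zero`, `imVec ∘ imQuat = id`); `hasStrictFDerivAt_pi_imVec_su2Quat_expPoint` — the bond-wise map on `ι → ℝ³` has strict derivative `id` at `0`.
§2 `qRead_eventuallyEq` — near `ζ = 0` the quaternion-read descent IS `(bond-wise imVec∘su2Quat∘expPoint) ∘ E⁻¹ ∘ (log-read descent)` (`Θ ∘ Λ = id` on the inner
   window ✓`expChart_logChart`, continuity ✓`continuousAt_descendTo_expPoint`, ✓`expPoint_eq_expChart`); ★★`hasStrictFDerivAt_qRead_descendTo` — under FILE C's guards
   (`U₀ ∈ histGood F ℰp θ K J`, `0 ≤ θ`, `(5L)²∕4·θ_i ≤ α` on `J < i ≤ K`, `α ≤ 1∕24`, `α < δ_{SU(2)}`, `157α < L⁻²`):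
   **`HasStrictFDerivAt Mq (DMq) 0 ∧ Surjective DMq ∧ ∀ E (Pauli coordinate equivalence), DMq = ↑E.symm ∘L DM`**.
§3 ★★★`qcritM_of_isLocalMinOn` ∕ ★★★`qcritM_of_argmin` — CRIT-m♮ for `DMq`: `(∃ lam, ∀ ζ, DA(U₀)[ζ] = lam (DMq ζ)) ∧ (∀ ζ ζ′, DMq ζ = DMq ζ′ → DA ζ = DA ζ′) ∧
   Surjective DMq` (`DA` = ✓p822511's pairing text, the CRIT-m♮ conjunct of ✓p823293 VERBATIM; the middle conjunct is (PRE)'s first conjunct for `DM := DMq`).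
§4 ★★★`qcritM_at` (registry prefix, numerics discharged as in ✓p824591 `critM_at`), ★★★`qcritM_of_thm1PairAtThree`, ★★★`qcritM_body_five` — ZERO HYPOTHESES at `L ≥ 5`.

HONEST SCOPE.  Chart bookkeeping over ✓p824591 and px13 g25's ✓p824474; nothing of Bałaban's analysis is asserted or proved here; (RINV-curl), AVG₂♭-ax, MULT♮, «CRIT-ax»,
(D-ax)∕(F-ax), GAP♯∘ (`stub_uniformFibreGapOrbit`, registry 3732b7df UNTOUCHED), S2β, the five registered stubs, 20520, `YM3TorusSU2` are NOT proved; rung R3 — NOT d = 4,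
NOT infinite volume, NOT a mass gap, NOT Clay.
-/

set_option autoImplicit false

noncomputable section

open scoped Matrix.Norms.L2Operator Topology RealInnerProductSpace Quaternion
open Filter Set Function
open Literature.MathematicalPhysics.QuantumLattice (su2Quat fundamentalRep fundamentalRep_apply)
open Literature.MathematicalPhysics.QuantumFieldTheory.Balaban1983to89
open Literature.MathematicalPhysics.QuantumFieldTheory.Balaban1983to89.HaarExponentialChart
open Literature.MathematicalPhysics.QuantumFieldTheory.Balaban1983to89.HaarExponentialChart.IsChartRep
open Literature.MathematicalPhysics.QuantumFieldTheory.Balaban1983to89.ExpMeanLog (expMeanLogSU deltaSU deltaSU_pos)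
open Literature.MathematicalPhysics.QuantumFieldTheory.Balaban1983to89.Node00
open Literature.MathematicalPhysics.QuantumFieldTheory.Balaban1983to89.T3ContinuumYM3Torus
open Literature.MathematicalPhysics.QuantumFieldTheory.Balaban1983to89.T3UnitLawDensityEML (ℰp)
open Literature.MathematicalPhysics.QuantumFieldTheory.Balaban1983to89.T3UnitScaleTilt
open Literature.MathematicalPhysics.QuantumFieldTheory.Balaban1983to89.T3TiltDescent
open Literature.MathematicalPhysics.QuantumFieldTheory.Balaban1983to89.T3ConstrainedMinimiser (fibre)
open Literature.MathematicalPhysics.QuantumFieldTheory.Balaban1983to89.T3DescentFibreTower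
open Literature.MathematicalPhysics.QuantumFieldTheory.Balaban1983to89.T3PrintedRegularMinimiser
open Literature.MathematicalPhysics.QuantumFieldTheory.Balaban1983to89.T3PrintedMinimiserExistence
open Literature.MathematicalPhysics.QuantumFieldTheory.Balaban1983to89.T3Thm1UniquenessSchema (Thm1UniqueMinOrbitAt)
open Literature.MathematicalPhysics.QuantumFieldTheory.Balaban1983to89.T3MinimiserStabilityReduction (θBal_pos)
open Literature.MathematicalPhysics.QuantumFieldTheory.Balaban1983to89.T3ThresholdSmallness (exists_forall_θBal_le)
open Literature.MathematicalPhysics.QuantumFieldTheory.Balaban1983to89.T4HaarSU2ExpChart (expPoint expPoint_zero imQuat su2Quat_expPoint)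
open Literature.MathematicalPhysics.QuantumFieldTheory.Balaban1983to89.T4ExpWindowSmallField (imVec)
open Literature.MathematicalPhysics.QuantumFieldTheory.Balaban1983to89.B15Prop1ChartSU2 (adSU2)
open Literature.MathematicalPhysics.QuantumFieldTheory.Balaban1983to89.B15Prop1ChartCalculusSU2 (imVecL imVecL_apply imVec_imQuat imQuatL)
open Literature.MathematicalPhysics.QuantumFieldTheory.Balaban1983to89.B10Eq18SigmaSU2 (su2Coord)
open Literature.MathematicalPhysics.QuantumFieldTheory.Balaban1983to89.B10Eq18SigmaSU2Haar (rev)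
open Literature.MathematicalPhysics.QuantumFieldTheory.Balaban1983to89.T4Continuum
open Summit.QuantumFields.YangMills.Theorems.FluctuationComparisonRegPrIntLS2BetaSymmetriesLiftOfCritical (thm1Pair_five thm1Pair_allL_of_three)
open Summit.QuantumFields.YangMills.Theorems.FluctuationComparisonRegPrIntLS2BetaArgminLocalMinOnFibre (isLocalMinOn_fibre_of_argmin)
open Summit.QuantumFields.YangMills.Theorems.FluctuationComparisonRegPrIntLS2BetaChartReadDescentOntoExpPoint
  (hasStrictFDerivAt_chartRead_descendTo_expPoint continuousAt_descendTo_expPoint relLogChart_window_mem_nhds su2Coord_rev_mem_lie expPoint_eq_expChart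
    exists_coordEquiv chartRead_descendTo_expPoint_apply_zero)
open Summit.QuantumFields.YangMills.Theorems.FluctuationComparisonRegPrIntLS2BetaCritMOfChartReadDescent (critM_of_isLocalMinOn)

namespace Summit.QuantumFields.YangMills.Theorems.FluctuationComparisonRegPrIntLS2BetaCritMQuaternionRead

/-! ## §1 The quaternion chart read `x ↦ imVec (su2Quat (expPoint x))` is tangent to the identity -/

section Pointwise

/-- ★ **`x ↦ imVec (su2Quat (expPoint x))` HAS STRICT DERIVATIVE `id` AT `0`** (`su2Quat (expPoint x) = exp (imQuat x)`, `D exp(0) = 1`, `imVec ∘ imQuat = id`).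
[cite: Balaban1985UV3, p. 260 (bookkeeping)] -/
theorem hasStrictFDerivAt_imVec_su2Quat_expPoint :
    HasStrictFDerivAt (fun x : EuclideanSpace ℝ (Fin 3) => imVec (su2Quat (expPoint x)))
      (ContinuousLinearMap.id ℝ (EuclideanSpace ℝ (Fin 3))) 0 := by
  have hfun : (fun x : EuclideanSpace ℝ (Fin 3) => imVec (su2Quat (expPoint x))) =
      fun x => imVecL (NormedSpace.exp (imQuatL x)) := by
    funext x; rw [su2Quat_expPoint, imVecL_apply]; rfl
  rw [hfun]
  have hexp : HasStrictFDerivAt (fun q : ℍ => NormedSpace.exp q) (1 : ℍ →L[ℝ] ℍ) (imQuatL (0 : EuclideanSpace ℝ (Fin 3))) := by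
    rw [map_zero]; exact hasStrictFDerivAt_exp_zero (𝕂 := ℝ)
  have h1 : HasStrictFDerivAt (fun x : EuclideanSpace ℝ (Fin 3) => NormedSpace.exp (imQuatL x)) ((1 : ℍ →L[ℝ] ℍ).comp imQuatL) 0 :=
    hexp.comp 0 imQuatL.hasStrictFDerivAt
  rw [ContinuousLinearMap.one_def, ContinuousLinearMap.id_comp] at h1
  have h2 : HasStrictFDerivAt (fun x : EuclideanSpace ℝ (Fin 3) => imVecL (NormedSpace.exp (imQuatL x))) (imVecL.comp imQuatL) 0 :=
    imVecL.hasStrictFDerivAt.comp 0 h1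
  refine h2.congr_fderiv (ContinuousLinearMap.ext fun v => ?_)
  have hv : imQuatL v = imQuat v := rfl
  rw [ContinuousLinearMap.comp_apply, imVecL_apply, hv, imVec_imQuat, ContinuousLinearMap.coe_id', id_eq]

/-- ★ **THE BOND-WISE QUATERNION CHART READ `y ↦ (B ↦ imVec (su2Quat (expPoint (y B))))` HAS STRICT DERIVATIVE `id` AT `0`.** [cite: Balaban1985UV3, p. 260 (bookkeeping)] -/
theorem hasStrictFDerivAt_pi_imVec_su2Quat_expPoint (ι : Type) [Fintype ι] :
    HasStrictFDerivAt (fun (y : ι → EuclideanSpace ℝ (Fin 3)) (B : ι) => imVec (su2Quat (expPoint (y B))))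
      (ContinuousLinearMap.id ℝ (ι → EuclideanSpace ℝ (Fin 3))) 0 := by
  refine hasStrictFDerivAt_pi'.2 fun B => ?_
  have hproj : HasStrictFDerivAt (fun y : ι → EuclideanSpace ℝ (Fin 3) => y B)
      (ContinuousLinearMap.proj (R := ℝ) (φ := fun _ : ι => EuclideanSpace ℝ (Fin 3)) B) 0 :=
    (ContinuousLinearMap.proj (R := ℝ) (φ := fun _ : ι => EuclideanSpace ℝ (Fin 3)) B).hasStrictFDerivAt
  have hq : HasStrictFDerivAt (fun x : EuclideanSpace ℝ (Fin 3) => imVec (su2Quat (expPoint x)))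
      (ContinuousLinearMap.id ℝ (EuclideanSpace ℝ (Fin 3))) ((fun y : ι → EuclideanSpace ℝ (Fin 3) => y B) 0) :=
    hasStrictFDerivAt_imVec_su2Quat_expPoint
  have hcomp := HasStrictFDerivAt.comp (0 : ι → EuclideanSpace ℝ (Fin 3)) (f := fun y : ι → EuclideanSpace ℝ (Fin 3) => y B) hq hproj
  rw [ContinuousLinearMap.id_comp] at hcomp
  refine hcomp.congr_fderiv (ContinuousLinearMap.ext fun v => ?_)
  rw [ContinuousLinearMap.comp_apply, ContinuousLinearMap.coe_id', id_eq]

end Pointwise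

/-! ## §2 The quaternion-read descent vs the log-read descent: `Mq = (imVec∘su2Quat∘expPoint)∘E⁻¹∘Mc` near `0`, hence `DMq = E⁻¹ ∘L DM` -/

section Organ

variable {F : T3Family}

/-- **NEAR `ζ = 0` THE QUATERNION-READ DESCENT FACTORS THROUGH THE LOG-READ DESCENT**: for a good history `U₀` (guard only, `(5L)²∕4·θ_i < δ_{SU(2)}`), eventually in `𝓝 0`,
`imVec (su2Quat (D(ζ) B·D(0) B⁻¹)) = imVec (su2Quat (expPoint ((E.symm (Λ-read ζ)) B)))` for every Pauli coordinate equivalence `E` (`Θ(Λ g) = g` on the inner window,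
✓`expChart_logChart`; the window is reached by ✓`continuousAt_descendTo_expPoint`). [cite: Balaban1987RG1, (0.4), (0.11) p.253; Balaban1985UV3, p. 260 (bookkeeping)] -/
theorem qRead_eventuallyEq {J K : ℕ} (hJK : J ≤ K) {θ : ℕ → ℝ} (hθ0 : ∀ i, 0 ≤ θ i)
    (hθδ : ∀ i, J < i → i ≤ K → (((5 * F.L : ℕ) : ℝ) ^ 2 / 4) * θ i < deltaSU (Fin 2))
    {U₀ : GaugeField (F.P K) 0 (SU 2)} (hUg : U₀ ∈ histGood F ℰp θ K J)
    (E : (PBond (F.P J) 0 → EuclideanSpace ℝ (Fin 3)) ≃L[ℝ] (PBond (F.P J) 0 → (specialUnitaryLogChart (Fin 2)).lie))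
    (hE : ∀ y B, E y B = ⟨su2Coord (rev (y B)), su2Coord_rev_mem_lie (y B)⟩) :
    (fun (ζ : PBond (F.P K) 0 → EuclideanSpace ℝ (Fin 3)) (B : PBond (F.P J) 0) =>
        imVec (su2Quat (descendTo F ℰp J K hJK (fun ℓ => expPoint (ζ ℓ) * U₀ ℓ) B * (descendTo F ℰp J K hJK U₀ B)⁻¹))) =ᶠ[𝓝 0]
      (fun (y : PBond (F.P J) 0 → EuclideanSpace ℝ (Fin 3)) (B : PBond (F.P J) 0) => imVec (su2Quat (expPoint (y B)))) ∘ ⇑E.symm ∘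
        (fun (ζ : PBond (F.P K) 0 → EuclideanSpace ℝ (Fin 3)) (B : PBond (F.P J) 0) =>
          (isChartRep_specialUnitaryGroup (n := Fin 2)).logChart
            (descendTo F ℰp J K hJK (fun ℓ => expPoint (ζ ℓ) * U₀ ℓ) B * (descendTo F ℰp J K hJK U₀ B)⁻¹)) := by
  have hcont := continuousAt_descendTo_expPoint (F := F) hJK hθ0 hθδ hUg
  have h0 : (fun ℓ => expPoint ((0 : PBond (F.P K) 0 → EuclideanSpace ℝ (Fin 3)) ℓ) * U₀ ℓ : GaugeField (F.P K) 0 (SU 2)) = U₀ := by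
    funext ℓ; rw [Pi.zero_apply, expPoint_zero, one_mul]
  have hO := relLogChart_window_mem_nhds (descendTo F ℰp J K hJK U₀)
  have hT : Tendsto (fun ζ : PBond (F.P K) 0 → EuclideanSpace ℝ (Fin 3) =>
      descendTo F ℰp J K hJK (fun ℓ => expPoint (ζ ℓ) * U₀ ℓ : GaugeField (F.P K) 0 (SU 2))) (𝓝 0) (𝓝 (descendTo F ℰp J K hJK U₀)) := by
    have h : Tendsto (fun ζ : PBond (F.P K) 0 → EuclideanSpace ℝ (Fin 3) =>
        descendTo F ℰp J K hJK (fun ℓ => expPoint (ζ ℓ) * U₀ ℓ : GaugeField (F.P K) 0 (SU 2))) (𝓝 0)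
        (𝓝 ((fun ζ : PBond (F.P K) 0 → EuclideanSpace ℝ (Fin 3) =>
          descendTo F ℰp J K hJK (fun ℓ => expPoint (ζ ℓ) * U₀ ℓ : GaugeField (F.P K) 0 (SU 2))) 0)) := hcont.tendsto
    have hval : (fun ζ : PBond (F.P K) 0 → EuclideanSpace ℝ (Fin 3) =>
          descendTo F ℰp J K hJK (fun ℓ => expPoint (ζ ℓ) * U₀ ℓ : GaugeField (F.P K) 0 (SU 2))) 0 = descendTo F ℰp J K hJK U₀ := by
      show descendTo F ℰp J K hJK (fun ℓ => expPoint ((0 : PBond (F.P K) 0 → EuclideanSpace ℝ (Fin 3)) ℓ) * U₀ ℓ) = _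
      rw [h0]
    rw [hval] at h
    exact h
  have hpre := hT.eventually hO
  filter_upwards [hpre] with ζ hζ
  funext B
  simp only [Function.comp_apply]
  rw [expPoint_eq_expChart, ← hE (E.symm _) B, E.apply_symm_apply]
  have hρ : ‖fundamentalRep (Fin 2) (descendTo F ℰp J K hJK (fun ℓ => expPoint (ζ ℓ) * U₀ ℓ) B * (descendTo F ℰp J K hJK U₀ B)⁻¹) - 1‖ <
      innerRadius (specialUnitaryLogChart (Fin 2)) := by
    rw [fundamentalRep_apply]; exact hζ B
  rw [(isChartRep_specialUnitaryGroup (n := Fin 2)).expChart_logChart hρ]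

/-- ★★ **THE QUATERNION-READ DESCENT IS STRICTLY DIFFERENTIABLE AT `0`, ITS DERIVATIVE `DMq(U₀)` IS ONTO, AND `DMq = E⁻¹ ∘L DM` FOR EVERY PAULI COORDINATE EQUIVALENCE `E`**
(under FILE C's guards; `DM` = ✓p824591's log-read derivative, (s1)(s2) = ✓`hasStrictFDerivAt_chartRead_descendTo_expPoint`).
[cite: Balaban1987RG1, (0.4), (0.8), (0.11) p.253; Balaban1985Averaging, Prop. 3 (122)-(124) p.36; Balaban1985UV3, p. 260] -/
theorem hasStrictFDerivAt_qRead_descendTo {J K : ℕ} (hJK : J ≤ K) {θ : ℕ → ℝ} (hθ0 : ∀ i, 0 ≤ θ i) {α : ℝ}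
    (hθα : ∀ i, J < i → i ≤ K → (((5 * F.L : ℕ) : ℝ) ^ 2 / 4) * θ i ≤ α)
    (hα24 : α ≤ 1 / 24) (hαδ : α < deltaSU (Fin 2)) (hαL : 157 * α < ((F.L : ℝ) ^ 2)⁻¹)
    {U₀ : GaugeField (F.P K) 0 (SU 2)} (hUg : U₀ ∈ histGood F ℰp θ K J) :
    HasStrictFDerivAt (fun (ζ : PBond (F.P K) 0 → EuclideanSpace ℝ (Fin 3)) (B : PBond (F.P J) 0) =>
        imVec (su2Quat (descendTo F ℰp J K hJK (fun ℓ => expPoint (ζ ℓ) * U₀ ℓ) B * (descendTo F ℰp J K hJK U₀ B)⁻¹)))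
      (fderiv ℝ (fun (ζ : PBond (F.P K) 0 → EuclideanSpace ℝ (Fin 3)) (B : PBond (F.P J) 0) =>
        imVec (su2Quat (descendTo F ℰp J K hJK (fun ℓ => expPoint (ζ ℓ) * U₀ ℓ) B * (descendTo F ℰp J K hJK U₀ B)⁻¹))) 0) 0 ∧
    Function.Surjective (fderiv ℝ (fun (ζ : PBond (F.P K) 0 → EuclideanSpace ℝ (Fin 3)) (B : PBond (F.P J) 0) =>
        imVec (su2Quat (descendTo F ℰp J K hJK (fun ℓ => expPoint (ζ ℓ) * U₀ ℓ) B * (descendTo F ℰp J K hJK U₀ B)⁻¹))) 0) ∧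
    ∀ (E : (PBond (F.P J) 0 → EuclideanSpace ℝ (Fin 3)) ≃L[ℝ] (PBond (F.P J) 0 → (specialUnitaryLogChart (Fin 2)).lie)),
      (∀ y B, E y B = ⟨su2Coord (rev (y B)), su2Coord_rev_mem_lie (y B)⟩) →
      fderiv ℝ (fun (ζ : PBond (F.P K) 0 → EuclideanSpace ℝ (Fin 3)) (B : PBond (F.P J) 0) =>
          imVec (su2Quat (descendTo F ℰp J K hJK (fun ℓ => expPoint (ζ ℓ) * U₀ ℓ) B * (descendTo F ℰp J K hJK U₀ B)⁻¹))) 0 =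
        (E.symm : (PBond (F.P J) 0 → (specialUnitaryLogChart (Fin 2)).lie) →L[ℝ] (PBond (F.P J) 0 → EuclideanSpace ℝ (Fin 3))).comp
          (fderiv ℝ (fun (ζ : PBond (F.P K) 0 → EuclideanSpace ℝ (Fin 3)) (B : PBond (F.P J) 0) =>
            (isChartRep_specialUnitaryGroup (n := Fin 2)).logChart
              (descendTo F ℰp J K hJK (fun ℓ => expPoint (ζ ℓ) * U₀ ℓ) B * (descendTo F ℰp J K hJK U₀ B)⁻¹)) 0) := by
  have hθδ : ∀ i, J < i → i ≤ K → (((5 * F.L : ℕ) : ℝ) ^ 2 / 4) * θ i < deltaSU (Fin 2) :=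
    fun i hi hiK => (hθα i hi hiK).trans_lt hαδ
  obtain ⟨hMc, hsurj⟩ := hasStrictFDerivAt_chartRead_descendTo_expPoint (F := F) hJK hθ0 hθα hα24 hαδ hαL hUg
  -- abbreviations
  set Mc := fun (ζ : PBond (F.P K) 0 → EuclideanSpace ℝ (Fin 3)) (B : PBond (F.P J) 0) =>
      (isChartRep_specialUnitaryGroup (n := Fin 2)).logChart
        (descendTo F ℰp J K hJK (fun ℓ => expPoint (ζ ℓ) * U₀ ℓ) B * (descendTo F ℰp J K hJK U₀ B)⁻¹) with hMcdef
  set Mq := fun (ζ : PBond (F.P K) 0 → EuclideanSpace ℝ (Fin 3)) (B : PBond (F.P J) 0) =>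
      imVec (su2Quat (descendTo F ℰp J K hJK (fun ℓ => expPoint (ζ ℓ) * U₀ ℓ) B * (descendTo F ℰp J K hJK U₀ B)⁻¹)) with hMqdef
  set Ψ := fun (y : PBond (F.P J) 0 → EuclideanSpace ℝ (Fin 3)) (B : PBond (F.P J) 0) => imVec (su2Quat (expPoint (y B))) with hΨdef
  have hMc0 : Mc 0 = 0 := chartRead_descendTo_expPoint_apply_zero (F := F) hJK U₀
  -- the strict derivative of `Mq` through any coordinate equivalence
  have key : ∀ (E : (PBond (F.P J) 0 → EuclideanSpace ℝ (Fin 3)) ≃L[ℝ] (PBond (F.P J) 0 → (specialUnitaryLogChart (Fin 2)).lie)),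
      (∀ y B, E y B = ⟨su2Coord (rev (y B)), su2Coord_rev_mem_lie (y B)⟩) →
      HasStrictFDerivAt Mq ((E.symm : (PBond (F.P J) 0 → (specialUnitaryLogChart (Fin 2)).lie) →L[ℝ]
        (PBond (F.P J) 0 → EuclideanSpace ℝ (Fin 3))).comp (fderiv ℝ Mc 0)) 0 := by
    intro E hE
    have hEs : HasStrictFDerivAt (⇑E.symm) (E.symm : (PBond (F.P J) 0 → (specialUnitaryLogChart (Fin 2)).lie) →L[ℝ]
        (PBond (F.P J) 0 → EuclideanSpace ℝ (Fin 3))) (Mc 0) :=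
      ContinuousLinearEquiv.hasStrictFDerivAt (𝕜 := ℝ) (E := PBond (F.P J) 0 → (specialUnitaryLogChart (Fin 2)).lie)
        (F := PBond (F.P J) 0 → EuclideanSpace ℝ (Fin 3)) (x := Mc 0) E.symm
    have h1 := HasStrictFDerivAt.comp (𝕜 := ℝ) (0 : PBond (F.P K) 0 → EuclideanSpace ℝ (Fin 3)) (f := Mc) (f' := fderiv ℝ Mc 0) (g := ⇑E.symm)
      (g' := (E.symm : (PBond (F.P J) 0 → (specialUnitaryLogChart (Fin 2)).lie) →L[ℝ] (PBond (F.P J) 0 → EuclideanSpace ℝ (Fin 3)))) hEs hMc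
    have hΨ : HasStrictFDerivAt Ψ (ContinuousLinearMap.id ℝ (PBond (F.P J) 0 → EuclideanSpace ℝ (Fin 3))) (E.symm (Mc 0)) := by
      rw [hMc0, map_zero]; exact hasStrictFDerivAt_pi_imVec_su2Quat_expPoint (PBond (F.P J) 0)
    have h2 := HasStrictFDerivAt.comp (0 : PBond (F.P K) 0 → EuclideanSpace ℝ (Fin 3)) (f := fun ζ => E.symm (Mc ζ)) (g := Ψ) hΨ h1
    rw [ContinuousLinearMap.id_comp] at h2
    have heq := qRead_eventuallyEq (F := F) hJK hθ0 hθδ hUg E hE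
    exact h2.congr_of_eventuallyEq heq.symm
  obtain ⟨E₀, hE₀⟩ := exists_coordEquiv (F.P J) 0
  have hD : fderiv ℝ Mq 0 = ((E₀.symm : (PBond (F.P J) 0 → (specialUnitaryLogChart (Fin 2)).lie) →L[ℝ]
      (PBond (F.P J) 0 → EuclideanSpace ℝ (Fin 3))).comp (fderiv ℝ Mc 0)) := (key E₀ hE₀).hasFDerivAt.fderiv
  refine ⟨?_, ?_, fun E hE => (key E hE).hasFDerivAt.fderiv⟩
  · rw [hD]; exact key E₀ hE₀
  · rw [hD, ContinuousLinearMap.coe_comp]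
    exact E₀.symm.surjective.comp hsurj

end Organ

/-! ## §3 CRIT-m♮ for the quaternion-read derivative `DMq(U₀)`: multiplier form, set form ((PRE)'s first conjunct), onto -/

section CritM

variable {F : T3Family}

/-- ★★★ **CRIT-m♮ FOR `DMq` AT A FIBRE-LOCAL MINIMUM WITH A GOOD HISTORY — MULTIPLIER FORM, SET FORM, ONTO**: under ✓p824591 `critM_of_isLocalMinOn`'s hypotheses,
`(∃ lam, ∀ ζ, DA(U₀)[ζ] = lam (DMq ζ)) ∧ (∀ ζ ζ′, DMq ζ = DMq ζ′ → DA ζ = DA ζ′) ∧ Surjective DMq` (`lam_q := lam ∘ E`, `DMq = E⁻¹ ∘L DM`).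
[cite: Balaban1985Variational, Thm 1 (8)-(10) p.279, (26) p.282, (171) p.305; Balaban1987RG1, (0.4) p.253] -/
theorem qcritM_of_isLocalMinOn {J K : ℕ} (hJK : J ≤ K) {θ : ℕ → ℝ} (hθ0 : ∀ i, 0 ≤ θ i) {α : ℝ}
    (hθα : ∀ i, J < i → i ≤ K → (((5 * F.L : ℕ) : ℝ) ^ 2 / 4) * θ i ≤ α)
    (hα24 : α ≤ 1 / 24) (hαδ : α < deltaSU (Fin 2)) (hαL : 157 * α < ((F.L : ℝ) ^ 2)⁻¹)
    {U₀ : GaugeField (F.P K) 0 (SU 2)} (hUg : U₀ ∈ histGood F ℰp θ K J)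
    (hloc : IsLocalMinOn (fun W : GaugeField (F.P K) 0 (SU 2) => wilsonAction4 W) (fibre F ℰp J K hJK (descendTo F ℰp J K hJK U₀)) U₀) :
    (∃ lam : (PBond (F.P J) 0 → EuclideanSpace ℝ (Fin 3)) → ℝ, ∀ ζ : PBond (F.P K) 0 → EuclideanSpace ℝ (Fin 3),
        (∑ p : Plaq (F.P K) 0, inner ℝ (imVec (su2Quat (GaugeField.plaqHol U₀ p)))
            (adSU2 (GaugeField.plaqHol U₀ p)⁻¹ (ζ ⟨p.src, p.μ⟩) + adSU2 ((GaugeField.plaqHol U₀ p)⁻¹ * U₀ ⟨p.src, p.μ⟩) (ζ ⟨p.src.shift p.μ, p.ν⟩) -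
              adSU2 ((GaugeField.plaqHol U₀ p)⁻¹ * U₀ ⟨p.src, p.μ⟩ * U₀ ⟨p.src.shift p.μ, p.ν⟩ * (U₀ ⟨p.src.shift p.ν, p.μ⟩)⁻¹) (ζ ⟨p.src.shift p.ν, p.μ⟩) -
              ζ ⟨p.src, p.ν⟩)) =
          lam ((fderiv ℝ (fun (ζ : PBond (F.P K) 0 → EuclideanSpace ℝ (Fin 3)) (B : PBond (F.P J) 0) =>
            imVec (su2Quat (descendTo F ℰp J K hJK (fun ℓ => expPoint (ζ ℓ) * U₀ ℓ) B * (descendTo F ℰp J K hJK U₀ B)⁻¹))) 0) ζ)) ∧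
    (∀ ζ ζ' : PBond (F.P K) 0 → EuclideanSpace ℝ (Fin 3),
        (fderiv ℝ (fun (ζ : PBond (F.P K) 0 → EuclideanSpace ℝ (Fin 3)) (B : PBond (F.P J) 0) =>
            imVec (su2Quat (descendTo F ℰp J K hJK (fun ℓ => expPoint (ζ ℓ) * U₀ ℓ) B * (descendTo F ℰp J K hJK U₀ B)⁻¹))) 0) ζ =
          (fderiv ℝ (fun (ζ : PBond (F.P K) 0 → EuclideanSpace ℝ (Fin 3)) (B : PBond (F.P J) 0) =>
            imVec (su2Quat (descendTo F ℰp J K hJK (fun ℓ => expPoint (ζ ℓ) * U₀ ℓ) B * (descendTo F ℰp J K hJK U₀ B)⁻¹))) 0) ζ' →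
        (∑ p : Plaq (F.P K) 0, inner ℝ (imVec (su2Quat (GaugeField.plaqHol U₀ p)))
            (adSU2 (GaugeField.plaqHol U₀ p)⁻¹ (ζ ⟨p.src, p.μ⟩) + adSU2 ((GaugeField.plaqHol U₀ p)⁻¹ * U₀ ⟨p.src, p.μ⟩) (ζ ⟨p.src.shift p.μ, p.ν⟩) -
              adSU2 ((GaugeField.plaqHol U₀ p)⁻¹ * U₀ ⟨p.src, p.μ⟩ * U₀ ⟨p.src.shift p.μ, p.ν⟩ * (U₀ ⟨p.src.shift p.ν, p.μ⟩)⁻¹) (ζ ⟨p.src.shift p.ν, p.μ⟩) -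
              ζ ⟨p.src, p.ν⟩)) =
          (∑ p : Plaq (F.P K) 0, inner ℝ (imVec (su2Quat (GaugeField.plaqHol U₀ p)))
            (adSU2 (GaugeField.plaqHol U₀ p)⁻¹ (ζ' ⟨p.src, p.μ⟩) + adSU2 ((GaugeField.plaqHol U₀ p)⁻¹ * U₀ ⟨p.src, p.μ⟩) (ζ' ⟨p.src.shift p.μ, p.ν⟩) -
              adSU2 ((GaugeField.plaqHol U₀ p)⁻¹ * U₀ ⟨p.src, p.μ⟩ * U₀ ⟨p.src.shift p.μ, p.ν⟩ * (U₀ ⟨p.src.shift p.ν, p.μ⟩)⁻¹) (ζ' ⟨p.src.shift p.ν, p.μ⟩) -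
              ζ' ⟨p.src, p.ν⟩))) ∧
    Function.Surjective
      (fderiv ℝ (fun (ζ : PBond (F.P K) 0 → EuclideanSpace ℝ (Fin 3)) (B : PBond (F.P J) 0) =>
            imVec (su2Quat (descendTo F ℰp J K hJK (fun ℓ => expPoint (ζ ℓ) * U₀ ℓ) B * (descendTo F ℰp J K hJK U₀ B)⁻¹))) 0) := by
  obtain ⟨⟨lam, hlam⟩, -⟩ := critM_of_isLocalMinOn hJK hθ0 hθα hα24 hαδ hαL hUg hloc
  obtain ⟨-, hqs, hqE⟩ := hasStrictFDerivAt_qRead_descendTo (F := F) hJK hθ0 hθα hα24 hαδ hαL hUg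
  obtain ⟨E, hE⟩ := exists_coordEquiv (F.P J) 0
  have hD := hqE E hE
  have hmult : ∀ ζ : PBond (F.P K) 0 → EuclideanSpace ℝ (Fin 3),
      (∑ p : Plaq (F.P K) 0, inner ℝ (imVec (su2Quat (GaugeField.plaqHol U₀ p)))
            (adSU2 (GaugeField.plaqHol U₀ p)⁻¹ (ζ ⟨p.src, p.μ⟩) + adSU2 ((GaugeField.plaqHol U₀ p)⁻¹ * U₀ ⟨p.src, p.μ⟩) (ζ ⟨p.src.shift p.μ, p.ν⟩) -
              adSU2 ((GaugeField.plaqHol U₀ p)⁻¹ * U₀ ⟨p.src, p.μ⟩ * U₀ ⟨p.src.shift p.μ, p.ν⟩ * (U₀ ⟨p.src.shift p.ν, p.μ⟩)⁻¹) (ζ ⟨p.src.shift p.ν, p.μ⟩) -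
              ζ ⟨p.src, p.ν⟩)) =
        lam (E ((fderiv ℝ (fun (ζ : PBond (F.P K) 0 → EuclideanSpace ℝ (Fin 3)) (B : PBond (F.P J) 0) =>
            imVec (su2Quat (descendTo F ℰp J K hJK (fun ℓ => expPoint (ζ ℓ) * U₀ ℓ) B * (descendTo F ℰp J K hJK U₀ B)⁻¹))) 0) ζ)) := fun ζ => by
    rw [hlam ζ, hD, ContinuousLinearMap.comp_apply, ContinuousLinearEquiv.coe_coe, ContinuousLinearEquiv.apply_symm_apply]
  exact ⟨⟨fun y => lam (E y), hmult⟩, fun ζ ζ' h => by rw [hmult ζ, hmult ζ', h], hqs⟩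

/-- ★★★ **CRIT-m♮ FOR `DMq` AT AN ARGMIN GOOD HISTORY** (✓(β) `isLocalMinOn_fibre_of_argmin` built in; hypotheses = ✓p824591 `critM_of_argmin`'s).
[cite: Balaban1985Variational, Thm 1 (8)-(10) p.279, (26) p.282, (171) p.305] -/
theorem qcritM_of_argmin {L : ℕ} {a₀ a₁ B₃ : ℝ} (hT : Thm1GlobalMinAt L a₀ a₁ B₃) (hU1 : Thm1UniqueMinOrbitAt L a₀ a₁ B₃)
    (hB₃ : 0 < B₃) (hFL : F.L = L) {ε₀ : ℝ} (hε₀ : 0 < ε₀) (hε₀a : ε₀ ≤ a₀) {θ : ℕ → ℝ} (hθpos : ∀ i, 0 < θ i)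
    (hθa : ∀ i, θ i ≤ a₁) (hθB : ∀ i, B₃ * θ i * (F.L : ℝ) ^ 3 ≤ ε₀) (hθ4 : ∀ i, 4 * θ i * (F.L : ℝ) ^ 3 < ε₀)
    {α : ℝ} (hθα : ∀ i, (((5 * F.L : ℕ) : ℝ) ^ 2 / 4) * θ i ≤ α)
    (hα24 : α ≤ 1 / 24) (hαδ : α < deltaSU (Fin 2)) (hαL : 157 * α < ((F.L : ℝ) ^ 2)⁻¹)
    {J K : ℕ} (hJK : J ≤ K) {V : GaugeField (F.P J) 0 (SU 2)}
    {U₀ : GaugeField (F.P K) 0 (SU 2)} (hUf : U₀ ∈ fibre F ℰp J K hJK V) (hUg : U₀ ∈ histGood F ℰp θ K J)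
    (hA : wilsonAction4 U₀ = minActionRegPr F J K hJK ε₀ V) :
    (∃ lam : (PBond (F.P J) 0 → EuclideanSpace ℝ (Fin 3)) → ℝ, ∀ ζ : PBond (F.P K) 0 → EuclideanSpace ℝ (Fin 3),
        (∑ p : Plaq (F.P K) 0, inner ℝ (imVec (su2Quat (GaugeField.plaqHol U₀ p)))
            (adSU2 (GaugeField.plaqHol U₀ p)⁻¹ (ζ ⟨p.src, p.μ⟩) + adSU2 ((GaugeField.plaqHol U₀ p)⁻¹ * U₀ ⟨p.src, p.μ⟩) (ζ ⟨p.src.shift p.μ, p.ν⟩) -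
              adSU2 ((GaugeField.plaqHol U₀ p)⁻¹ * U₀ ⟨p.src, p.μ⟩ * U₀ ⟨p.src.shift p.μ, p.ν⟩ * (U₀ ⟨p.src.shift p.ν, p.μ⟩)⁻¹) (ζ ⟨p.src.shift p.ν, p.μ⟩) -
              ζ ⟨p.src, p.ν⟩)) =
          lam ((fderiv ℝ (fun (ζ : PBond (F.P K) 0 → EuclideanSpace ℝ (Fin 3)) (B : PBond (F.P J) 0) =>
            imVec (su2Quat (descendTo F ℰp J K hJK (fun ℓ => expPoint (ζ ℓ) * U₀ ℓ) B * (descendTo F ℰp J K hJK U₀ B)⁻¹))) 0) ζ)) ∧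
    (∀ ζ ζ' : PBond (F.P K) 0 → EuclideanSpace ℝ (Fin 3),
        (fderiv ℝ (fun (ζ : PBond (F.P K) 0 → EuclideanSpace ℝ (Fin 3)) (B : PBond (F.P J) 0) =>
            imVec (su2Quat (descendTo F ℰp J K hJK (fun ℓ => expPoint (ζ ℓ) * U₀ ℓ) B * (descendTo F ℰp J K hJK U₀ B)⁻¹))) 0) ζ =
          (fderiv ℝ (fun (ζ : PBond (F.P K) 0 → EuclideanSpace ℝ (Fin 3)) (B : PBond (F.P J) 0) =>
            imVec (su2Quat (descendTo F ℰp J K hJK (fun ℓ => expPoint (ζ ℓ) * U₀ ℓ) B * (descendTo F ℰp J K hJK U₀ B)⁻¹))) 0) ζ' →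
        (∑ p : Plaq (F.P K) 0, inner ℝ (imVec (su2Quat (GaugeField.plaqHol U₀ p)))
            (adSU2 (GaugeField.plaqHol U₀ p)⁻¹ (ζ ⟨p.src, p.μ⟩) + adSU2 ((GaugeField.plaqHol U₀ p)⁻¹ * U₀ ⟨p.src, p.μ⟩) (ζ ⟨p.src.shift p.μ, p.ν⟩) -
              adSU2 ((GaugeField.plaqHol U₀ p)⁻¹ * U₀ ⟨p.src, p.μ⟩ * U₀ ⟨p.src.shift p.μ, p.ν⟩ * (U₀ ⟨p.src.shift p.ν, p.μ⟩)⁻¹) (ζ ⟨p.src.shift p.ν, p.μ⟩) -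
              ζ ⟨p.src, p.ν⟩)) =
          (∑ p : Plaq (F.P K) 0, inner ℝ (imVec (su2Quat (GaugeField.plaqHol U₀ p)))
            (adSU2 (GaugeField.plaqHol U₀ p)⁻¹ (ζ' ⟨p.src, p.μ⟩) + adSU2 ((GaugeField.plaqHol U₀ p)⁻¹ * U₀ ⟨p.src, p.μ⟩) (ζ' ⟨p.src.shift p.μ, p.ν⟩) -
              adSU2 ((GaugeField.plaqHol U₀ p)⁻¹ * U₀ ⟨p.src, p.μ⟩ * U₀ ⟨p.src.shift p.μ, p.ν⟩ * (U₀ ⟨p.src.shift p.ν, p.μ⟩)⁻¹) (ζ' ⟨p.src.shift p.ν, p.μ⟩) -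
              ζ' ⟨p.src, p.ν⟩))) ∧
    Function.Surjective
      (fderiv ℝ (fun (ζ : PBond (F.P K) 0 → EuclideanSpace ℝ (Fin 3)) (B : PBond (F.P J) 0) =>
            imVec (su2Quat (descendTo F ℰp J K hJK (fun ℓ => expPoint (ζ ℓ) * U₀ ℓ) B * (descendTo F ℰp J K hJK U₀ B)⁻¹))) 0) := by
  have hV : descendTo F ℰp J K hJK U₀ = V := (mem_fibre_iff F ℰp).mp hUf
  have hloc := isLocalMinOn_fibre_of_argmin hT hU1 hB₃ hFL hε₀ hε₀a hθpos hθa hθB hθ4 hJK hUf hUg hA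
  rw [← hV] at hloc
  exact qcritM_of_isLocalMinOn hJK (fun i => (hθpos i).le) (fun i _ _ => hθα i) hα24 hαδ hαL hUg hloc

end CritM

end Summit.QuantumFields.YangMills.Theorems.FluctuationComparisonRegPrIntLS2BetaCritMQuaternionRead

end
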